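import Summits.HubbardSuperconductivity.HubbardSuperconductivity.Theorems.KLProgrammeKLRegimeScaleZeroCovarianceKernelFreqRegularity
import Summits.HubbardSuperconductivity.HubbardSuperconductivity.Theorems.KLProgrammeScaleZeroCovarianceMomentumJetsTab
import Literature.Analysis.Fourier.FermionicPoissonSummationDecay

/-!
# Route `KLProgramme`, crux K3 — engine-flow child (stmt-HubbardSuperconductivity-20437), stub (C) at `n = 0`, located item #22a «(C)-SCALE0-PT2»,
# §2c (β1): the infinite-lattice frequency series of the off-site kernel IS the antiperiodic sum over images of its `β = ∞` time kernel —
# D3/D4 applied to `G = ω ↦ a¹_ω(−z)` with the hypotheses of `…KernelFreqRegularity`, in the engine's phase convention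

Cell gate-hubbard-kl, seat p1 g20.  With `G(ω) := a¹_ω(−z) = mFourierCoeff (Torus.descend g¹_ω) (−z)` (`z ≠ 0`), `…KernelFreqRegularity` proves `G ∈ C²`,
`G, G′, G″ ∈ L¹`, `G = O(|ω|⁻²)`; hence (`Literature.Analysis.Fourier.FermionicPoissonSummation[Decay]`):

* §1 `latticeKernel_fourier_sq_decay` — `‖𝓕G(t/2π)‖ ≤ V₂/t²`, `V₂ = ∫‖G″‖` (`norm_fourier_div_two_pi_le`); `latticeKernel_images_summable` (τ ∈ [0, β]);
  **`latticeKernel_fermionicMatsubaraSum_eq_tsum_images`** — `(1/β)Σ'_n e^{-iω_nτ}G(ω_n) = (1/2π)Σ'_m (−1)^m 𝓕G((mβ+τ)/2π)` for EVERY real `τ` with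
  summable images, in particular `τ ∈ [0, β]`; **`latticeKernel_norm_fermionicMatsubaraSum_sub_nearestImages_le`** — the two nearest images carry the sum
  up to `V₂·π/(6β²)`;
* §2 the ENGINE's phase `e^{+iω_nΔτ}`, `Δτ = τ_a − τ_b ∈ (−β, β)`: `cexp_matsubara_mul_beta` (`e^{iω_nβ} = −1`),
  **`tsum_kernelTerm_eq_tsum_images_of_nonpos`** (`Δτ ∈ [−β, 0]`: `Σ'_n (1/β)e^{iω_nΔτ}G(ω_n) = (1/2π)Σ'_m(−1)^m𝓕G((mβ − Δτ)/2π)`) and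
  **`tsum_kernelTerm_eq_neg_tsum_images_of_nonneg`** (`Δτ ∈ [0, β]`: `= −(1/2π)Σ'_m(−1)^m𝓕G((mβ + (β − Δτ))/2π)`, antiperiodicity);
* §3 the BARE FRAME `K = 0`, table-free (`B = klChi2CauchyTab 2`, `D_K = 4`): `latticeKernel_freq_poissonHyps_bare_of_ne_zero`,
  **`tsum_kernelTerm_eq_tsum_images_bare_of_nonpos`**, **`tsum_kernelTerm_eq_neg_tsum_images_bare_of_nonneg`** — no hypothesis beyond
  `0 ≤ c`, `0 < Λ`, `0 < β`, `z ≠ 0`, `Δτ ∈ [−β, β]`.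

With `…OffSiteLatticeSeries` ((M)+(L): the engine's window sum `= Σ'_n (1/β)e^{iω_nΔτ}G(ω_n)` ± two explicit tails) this closes the analytic side of
SPEC v2 §2a+§2c(β1) for the off-site rows: the scale-`0` entry at grid points `x_a ≠ x_b` is the alternating image sum of the `β = ∞` infinite-lattice
kernel `ǧ(t)(−z) = (1/2π)𝓕G(t/2π)` — the certified object — up to the window tail, the torus tail, and (if only the two nearest images are kept) `V₂π/(6β²)`.

Proofs only; no definitions; nothing here asserts (C), any stub of 20437, K3 or superconductivity.  References: BGM 2006 §2.1 (2.3)–(2.4)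
[cite: BenfattoGiulianiMastropietro2006]; Fetter–Walecka 1971 Ch. 7 §25 [cite: FetterWalecka1971]; Stein–Weiss 1971 VII Cor. 2.6 [cite: SteinWeiss1971].
-/

noncomputable section

namespace Summit.HubbardSuperconductivity.HubbardSuperconductivity.Theorems.KLRegimeSplit

set_option linter.dupNamespace false -- summit = problem name (single-conjunct summit), D-0017

open Literature.MathematicalPhysics.QuantumLattice Literature.Probability.LatticeModels Literature.Analysis.FunctionSpaces
open Literature.Analysis.Fourier
open Summit.HubbardSuperconductivity.HubbardSuperconductivity.Theorems.DispersionFlow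
open MeasureTheory Set Filter Asymptotics Complex UnitAddTorus Real
open scoped FourierTransform

variable {L : ℕ} [NeZero L]

/-! ## §1 D3/D4 for `G = a¹_·(−z)`, `z ≠ 0` -/

section Kernel

variable {c Λ : ℝ} (hc : 0 ≤ c) (hΛ : 0 < Λ) (μ : ℝ) (K : TrigPolyC4v) {B : ℝ} (hB1 : 1 ≤ B)
  (hB : ∀ i ≤ 2, ∀ t, ‖iteratedDeriv i salmhoferCutoff t‖ ≤ B) {DK : ℝ} (hK : ∀ q : Momentum, ‖iteratedFDeriv ℝ 1 (frameLevel μ K) q‖ ≤ DK)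
  {z : Site 2} (hz : z ≠ 0)
include hc hΛ hB1 hB hK hz

/-- **Quadratic Fourier decay of the kernel's frequency profile**: `‖𝓕G(t/2π)‖ ≤ (∫‖G″‖)/t²` for `t ≠ 0`, `G = ω ↦ a_ω(z)`, `z ≠ 0`. -/
theorem latticeKernel_fourier_sq_decay {t : ℝ} (ht : t ≠ 0) :
    ‖𝓕 (fun om : ℝ => mFourierCoeff (Torus.descend (fun y : Momentum => uvSymbolFn c Λ (frameLevel μ K ((2 * π) • y)) om)
        (uvSpatialSymbol_isLatticePeriodic c Λ μ K om)) z) (t / (2 * π))‖ ≤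
      (∫ x : ℝ, ‖iteratedDeriv 2 (fun om : ℝ => mFourierCoeff (Torus.descend (fun y : Momentum => uvSymbolFn c Λ (frameLevel μ K ((2 * π) • y)) om)
        (uvSpatialSymbol_isLatticePeriodic c Λ μ K om)) z) x‖) / t ^ 2 := by
  obtain ⟨h2, hint, -⟩ := latticeKernel_freq_poissonHyps_of_ne_zero hc hΛ μ K hB1 hB hK hz
  exact norm_fourier_div_two_pi_le h2 hint ht

/-- **The images are summable** for `τ ∈ [0, β]`. -/
theorem latticeKernel_images_summable {β : ℝ} (hβ : 0 < β) {τ : ℝ} (hτ0 : 0 ≤ τ) (hτβ : τ ≤ β) :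
    Summable fun m : ℤ => 𝓕 (fun om : ℝ => mFourierCoeff (Torus.descend (fun y : Momentum => uvSymbolFn c Λ (frameLevel μ K ((2 * π) • y)) om)
        (uvSpatialSymbol_isLatticePeriodic c Λ μ K om)) z) ((m * β + τ) / (2 * π)) :=
  summable_images_of_sq_decay hβ hτ0 hτβ fun _ ht => latticeKernel_fourier_sq_decay hc hΛ μ K hB1 hB hK hz ht

/-- **(β1) for the infinite-lattice kernel** (D3 `fermionicMatsubaraSum_eq_tsum_images` with its hypotheses discharged): for `z ≠ 0`, `β > 0` and every
real `τ` at which the images are summable (e.g. `τ ∈ [0, β]`, `latticeKernel_images_summable`),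
`(1/β)Σ'_n e^{-iω_nτ} a_{ω_n}(z) = (1/2π)Σ'_m (−1)^m 𝓕(a_·(z))((mβ+τ)/2π)`. -/
theorem latticeKernel_fermionicMatsubaraSum_eq_tsum_images {β : ℝ} (hβ : 0 < β) (τ : ℝ)
    (hsum : Summable fun m : ℤ => 𝓕 (fun om : ℝ => mFourierCoeff (Torus.descend (fun y : Momentum => uvSymbolFn c Λ (frameLevel μ K ((2 * π) • y)) om)
        (uvSpatialSymbol_isLatticePeriodic c Λ μ K om)) z) ((m * β + τ) / (2 * π))) :
    ((1 / β : ℝ) : ℂ) * ∑' n : ℤ, cexp (-(I * (((2 * n + 1) * π / β : ℝ) : ℂ) * τ)) *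
        mFourierCoeff (Torus.descend (fun y : Momentum => uvSymbolFn c Λ (frameLevel μ K ((2 * π) • y)) ((2 * n + 1) * π / β))
          (uvSpatialSymbol_isLatticePeriodic c Λ μ K ((2 * n + 1) * π / β))) z =
      ((1 / (2 * π) : ℝ) : ℂ) * ∑' m : ℤ, (-1 : ℂ) ^ m * 𝓕 (fun om : ℝ => mFourierCoeff (Torus.descend
        (fun y : Momentum => uvSymbolFn c Λ (frameLevel μ K ((2 * π) • y)) om) (uvSpatialSymbol_isLatticePeriodic c Λ μ K om)) z) ((m * β + τ) / (2 * π)) := by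
  obtain ⟨h2, -, hO⟩ := latticeKernel_freq_poissonHyps_of_ne_zero hc hΛ μ K hB1 hB hK hz
  exact fermionicMatsubaraSum_eq_tsum_images h2.continuous one_lt_two hO hβ τ hsum

/-- **Two nearest images** (D4 `norm_fermionicMatsubaraSum_sub_nearestImages_le_of_iteratedDeriv`): for `z ≠ 0`, `β > 0`, `τ ∈ [0, β]`,
`‖(1/β)Σ'_n e^{-iω_nτ} a_{ω_n}(z) − (1/2π)(𝓕G(τ/2π) − 𝓕G((τ−β)/2π))‖ ≤ (∫‖G″‖)·π/(6β²)`. -/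
theorem latticeKernel_norm_fermionicMatsubaraSum_sub_nearestImages_le {β : ℝ} (hβ : 0 < β) {τ : ℝ} (hτ0 : 0 ≤ τ) (hτβ : τ ≤ β) :
    ‖((1 / β : ℝ) : ℂ) * ∑' n : ℤ, cexp (-(I * (((2 * n + 1) * π / β : ℝ) : ℂ) * τ)) *
          mFourierCoeff (Torus.descend (fun y : Momentum => uvSymbolFn c Λ (frameLevel μ K ((2 * π) • y)) ((2 * n + 1) * π / β))
            (uvSpatialSymbol_isLatticePeriodic c Λ μ K ((2 * n + 1) * π / β))) z -
        ((1 / (2 * π) : ℝ) : ℂ) * (𝓕 (fun om : ℝ => mFourierCoeff (Torus.descend (fun y : Momentum => uvSymbolFn c Λ (frameLevel μ K ((2 * π) • y)) om)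
            (uvSpatialSymbol_isLatticePeriodic c Λ μ K om)) z) (τ / (2 * π)) -
          𝓕 (fun om : ℝ => mFourierCoeff (Torus.descend (fun y : Momentum => uvSymbolFn c Λ (frameLevel μ K ((2 * π) • y)) om)
            (uvSpatialSymbol_isLatticePeriodic c Λ μ K om)) z) ((τ - β) / (2 * π)))‖ ≤
      (∫ x : ℝ, ‖iteratedDeriv 2 (fun om : ℝ => mFourierCoeff (Torus.descend (fun y : Momentum => uvSymbolFn c Λ (frameLevel μ K ((2 * π) • y)) om)
        (uvSpatialSymbol_isLatticePeriodic c Λ μ K om)) z) x‖) * π / (6 * β ^ 2) := by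
  obtain ⟨h2, hint, hO⟩ := latticeKernel_freq_poissonHyps_of_ne_zero hc hΛ μ K hB1 hB hK hz
  exact norm_fermionicMatsubaraSum_sub_nearestImages_le_of_iteratedDeriv h2 hint one_lt_two hO hβ hτ0 hτβ

end Kernel

/-! ## §2 The engine's phase convention `e^{+iω_nΔτ}`, `Δτ ∈ (−β, β)` -/

/-- Antiperiodicity of the fermionic characters: `e^{iω_nβ} = −1`, `ω_n = (2n+1)π/β` (`β ≠ 0`). -/
theorem cexp_matsubara_mul_beta {β : ℝ} (hβ : β ≠ 0) (n : ℤ) : cexp (I * ((((2 * n + 1) * π / β) * β : ℝ) : ℂ)) = -1 := by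
  have h : (((2 * n + 1) * π / β) * β : ℝ) = (2 * n + 1) * π := by field_simp
  rw [h]
  have h2 : I * (((2 * n + 1) * π : ℝ) : ℂ) = (n : ℂ) * (2 * π * I) + π * I := by push_cast; ring
  rw [h2, Complex.exp_add, Complex.exp_int_mul_two_pi_mul_I, one_mul, Complex.exp_pi_mul_I]

/-- **Engine phase, `Δτ ∈ [−β, 0]`** (then `τ := −Δτ ∈ [0, β]` in D3's convention): for `G : ℝ → ℂ` and `β`,
`Σ'_n (1/β)·e^{iω_nΔτ}·G(ω_n) = (1/β)·Σ'_n e^{-iω_n(−Δτ)}·G(ω_n)` — pure rewriting, no hypothesis. -/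
theorem tsum_kernelTerm_eq_fermionicMatsubaraSum_neg (G : ℝ → ℂ) (β Δτ : ℝ) :
    ∑' n : ℤ, ((1 / β : ℝ) : ℂ) * cexp (I * (((2 * n + 1) * π / β * Δτ : ℝ) : ℂ)) * G ((2 * n + 1) * π / β) =
      ((1 / β : ℝ) : ℂ) * ∑' n : ℤ, cexp (-(I * (((2 * n + 1) * π / β : ℝ) : ℂ) * ((-Δτ : ℝ) : ℂ))) * G ((2 * n + 1) * π / β) := by
  rw [← tsum_mul_left]
  refine tsum_congr fun n => ?_
  rw [mul_assoc]
  congr 2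
  push_cast
  ring_nf

/-- **Engine phase, `Δτ ∈ [0, β]`** (then `τ := β − Δτ ∈ [0, β]` and one sign from antiperiodicity): for `G : ℝ → ℂ`, `β ≠ 0`,
`Σ'_n (1/β)·e^{iω_nΔτ}·G(ω_n) = −(1/β)·Σ'_n e^{-iω_n(β−Δτ)}·G(ω_n)`. -/
theorem tsum_kernelTerm_eq_neg_fermionicMatsubaraSum_sub {β : ℝ} (hβ : β ≠ 0) (G : ℝ → ℂ) (Δτ : ℝ) :
    ∑' n : ℤ, ((1 / β : ℝ) : ℂ) * cexp (I * (((2 * n + 1) * π / β * Δτ : ℝ) : ℂ)) * G ((2 * n + 1) * π / β) =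
      -(((1 / β : ℝ) : ℂ) * ∑' n : ℤ, cexp (-(I * (((2 * n + 1) * π / β : ℝ) : ℂ) * ((β - Δτ : ℝ) : ℂ))) * G ((2 * n + 1) * π / β)) := by
  rw [← tsum_mul_left, ← tsum_neg]
  refine tsum_congr fun n => ?_
  have hkey : cexp (I * (((2 * n + 1) * π / β * Δτ : ℝ) : ℂ)) = -cexp (-(I * (((2 * n + 1) * π / β : ℝ) : ℂ) * ((β - Δτ : ℝ) : ℂ))) := by
    have h1 : I * (((2 * n + 1) * π / β * Δτ : ℝ) : ℂ) =
        -(I * (((2 * n + 1) * π / β : ℝ) : ℂ) * ((β - Δτ : ℝ) : ℂ)) + I * ((((2 * n + 1) * π / β) * β : ℝ) : ℂ) := by push_cast; ring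
    rw [h1, Complex.exp_add, cexp_matsubara_mul_beta hβ n]
    ring
  rw [hkey]
  ring

section KernelPhase

variable {c Λ : ℝ} (hc : 0 ≤ c) (hΛ : 0 < Λ) (μ : ℝ) (K : TrigPolyC4v) {B : ℝ} (hB1 : 1 ≤ B)
  (hB : ∀ i ≤ 2, ∀ t, ‖iteratedDeriv i salmhoferCutoff t‖ ≤ B) {DK : ℝ} (hK : ∀ q : Momentum, ‖iteratedFDeriv ℝ 1 (frameLevel μ K) q‖ ≤ DK)
  {z : Site 2} (hz : z ≠ 0)
include hc hΛ hB1 hB hK hz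

/-- **(β1) in the engine's phase, `Δτ ∈ [−β, 0]`**: `Σ'_n (1/β)e^{iω_nΔτ}a_{ω_n}(z) = (1/2π)Σ'_m (−1)^m 𝓕(a_·(z))((mβ − Δτ)/2π)` (`z ≠ 0`, `β > 0`). -/
theorem tsum_kernelTerm_eq_tsum_images_of_nonpos {β : ℝ} (hβ : 0 < β) {Δτ : ℝ} (h0 : Δτ ≤ 0) (hβ' : -β ≤ Δτ) :
    ∑' n : ℤ, ((1 / β : ℝ) : ℂ) * cexp (I * (((2 * n + 1) * π / β * Δτ : ℝ) : ℂ)) *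
        mFourierCoeff (Torus.descend (fun y : Momentum => uvSymbolFn c Λ (frameLevel μ K ((2 * π) • y)) ((2 * n + 1) * π / β))
          (uvSpatialSymbol_isLatticePeriodic c Λ μ K ((2 * n + 1) * π / β))) z =
      ((1 / (2 * π) : ℝ) : ℂ) * ∑' m : ℤ, (-1 : ℂ) ^ m * 𝓕 (fun om : ℝ => mFourierCoeff (Torus.descend
        (fun y : Momentum => uvSymbolFn c Λ (frameLevel μ K ((2 * π) • y)) om) (uvSpatialSymbol_isLatticePeriodic c Λ μ K om)) z)
        ((m * β + -Δτ) / (2 * π)) := by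
  have h := tsum_kernelTerm_eq_fermionicMatsubaraSum_neg (fun om : ℝ => mFourierCoeff (Torus.descend
    (fun y : Momentum => uvSymbolFn c Λ (frameLevel μ K ((2 * π) • y)) om) (uvSpatialSymbol_isLatticePeriodic c Λ μ K om)) z) β Δτ
  beta_reduce at h
  rw [h]
  exact latticeKernel_fermionicMatsubaraSum_eq_tsum_images hc hΛ μ K hB1 hB hK hz hβ (-Δτ)
    (latticeKernel_images_summable hc hΛ μ K hB1 hB hK hz hβ (by linarith) (by linarith))

/-- **(β1) in the engine's phase, `Δτ ∈ [0, β]`**: `Σ'_n (1/β)e^{iω_nΔτ}a_{ω_n}(z) = −(1/2π)Σ'_m (−1)^m 𝓕(a_·(z))((mβ + (β − Δτ))/2π)`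
(`z ≠ 0`, `β > 0`; antiperiodicity in imaginary time). -/
theorem tsum_kernelTerm_eq_neg_tsum_images_of_nonneg {β : ℝ} (hβ : 0 < β) {Δτ : ℝ} (h0 : 0 ≤ Δτ) (hβ' : Δτ ≤ β) :
    ∑' n : ℤ, ((1 / β : ℝ) : ℂ) * cexp (I * (((2 * n + 1) * π / β * Δτ : ℝ) : ℂ)) *
        mFourierCoeff (Torus.descend (fun y : Momentum => uvSymbolFn c Λ (frameLevel μ K ((2 * π) • y)) ((2 * n + 1) * π / β))
          (uvSpatialSymbol_isLatticePeriodic c Λ μ K ((2 * n + 1) * π / β))) z =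
      -(((1 / (2 * π) : ℝ) : ℂ) * ∑' m : ℤ, (-1 : ℂ) ^ m * 𝓕 (fun om : ℝ => mFourierCoeff (Torus.descend
        (fun y : Momentum => uvSymbolFn c Λ (frameLevel μ K ((2 * π) • y)) om) (uvSpatialSymbol_isLatticePeriodic c Λ μ K om)) z)
        ((m * β + (β - Δτ)) / (2 * π))) := by
  have h := tsum_kernelTerm_eq_neg_fermionicMatsubaraSum_sub hβ.ne' (fun om : ℝ => mFourierCoeff (Torus.descend
    (fun y : Momentum => uvSymbolFn c Λ (frameLevel μ K ((2 * π) • y)) om) (uvSpatialSymbol_isLatticePeriodic c Λ μ K om)) z) Δτ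
  beta_reduce at h
  rw [h, latticeKernel_fermionicMatsubaraSum_eq_tsum_images hc hΛ μ K hB1 hB hK hz hβ (β - Δτ)
    (latticeKernel_images_summable hc hΛ μ K hB1 hB hK hz hβ (by linarith) (by linarith))]

end KernelPhase


/-! ## §3 The bare frame `K = 0` with the proved cutoff table: hypothesis-free -/

/-- **D3/D4 hypothesis list at the bare frame, table-free**: for `0 ≤ c`, `0 < Λ`, `z ≠ 0`, `G = ω ↦ a_ω(z)` at `K = 0` is `C²`, has `G, G′, G″`
integrable and is `O(|ω|⁻²)` (`B = klChi2CauchyTab 2`, `D_K = 4`). -/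
theorem latticeKernel_freq_poissonHyps_bare_of_ne_zero {c Λ : ℝ} (hc : 0 ≤ c) (hΛ : 0 < Λ) (μ : ℝ) {z : Site 2} (hz : z ≠ 0) :
    ContDiff ℝ 2 (fun om : ℝ => mFourierCoeff (Torus.descend (fun y : Momentum => uvSymbolFn c Λ (frameLevel μ 0 ((2 * π) • y)) om)
        (uvSpatialSymbol_isLatticePeriodic c Λ μ 0 om)) z) ∧
      (∀ n : ℕ, n ≤ 2 → Integrable (iteratedDeriv n (fun om : ℝ => mFourierCoeff (Torus.descend
        (fun y : Momentum => uvSymbolFn c Λ (frameLevel μ 0 ((2 * π) • y)) om) (uvSpatialSymbol_isLatticePeriodic c Λ μ 0 om)) z))) ∧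
      (fun om : ℝ => mFourierCoeff (Torus.descend (fun y : Momentum => uvSymbolFn c Λ (frameLevel μ 0 ((2 * π) • y)) om)
        (uvSpatialSymbol_isLatticePeriodic c Λ μ 0 om)) z) =O[cocompact ℝ] fun x : ℝ => |x| ^ (-(2 : ℝ)) :=
  latticeKernel_freq_poissonHyps_of_ne_zero hc hΛ μ 0 (one_le_klChi2CauchyTab 2) (salmhoferCutoff_flat_cauchy_table_deriv 2)
    (fun q => Summit.HubbardSuperconductivity.HubbardSuperconductivity.Theorems.EngineV8.norm_iteratedFDeriv_frameLevel_zero_le μ le_rfl q) hz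

/-- **(β1) at the bare frame in the engine's phase, `Δτ ∈ [−β, 0]`, table-free** (`z ≠ 0`, `β > 0`, `0 ≤ c`, `0 < Λ`). -/
theorem tsum_kernelTerm_eq_tsum_images_bare_of_nonpos {c Λ : ℝ} (hc : 0 ≤ c) (hΛ : 0 < Λ) (μ : ℝ) {z : Site 2} (hz : z ≠ 0)
    {β : ℝ} (hβ : 0 < β) {Δτ : ℝ} (h0 : Δτ ≤ 0) (hβ' : -β ≤ Δτ) :
    ∑' n : ℤ, ((1 / β : ℝ) : ℂ) * cexp (I * (((2 * n + 1) * π / β * Δτ : ℝ) : ℂ)) *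
        mFourierCoeff (Torus.descend (fun y : Momentum => uvSymbolFn c Λ (frameLevel μ 0 ((2 * π) • y)) ((2 * n + 1) * π / β))
          (uvSpatialSymbol_isLatticePeriodic c Λ μ 0 ((2 * n + 1) * π / β))) z =
      ((1 / (2 * π) : ℝ) : ℂ) * ∑' m : ℤ, (-1 : ℂ) ^ m * 𝓕 (fun om : ℝ => mFourierCoeff (Torus.descend
        (fun y : Momentum => uvSymbolFn c Λ (frameLevel μ 0 ((2 * π) • y)) om) (uvSpatialSymbol_isLatticePeriodic c Λ μ 0 om)) z)
        ((m * β + -Δτ) / (2 * π)) :=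
  tsum_kernelTerm_eq_tsum_images_of_nonpos hc hΛ μ 0 (one_le_klChi2CauchyTab 2) (salmhoferCutoff_flat_cauchy_table_deriv 2)
    (fun q => Summit.HubbardSuperconductivity.HubbardSuperconductivity.Theorems.EngineV8.norm_iteratedFDeriv_frameLevel_zero_le μ le_rfl q) hz hβ h0 hβ'

/-- **(β1) at the bare frame in the engine's phase, `Δτ ∈ [0, β]`, table-free** (`z ≠ 0`, `β > 0`, `0 ≤ c`, `0 < Λ`). -/
theorem tsum_kernelTerm_eq_neg_tsum_images_bare_of_nonneg {c Λ : ℝ} (hc : 0 ≤ c) (hΛ : 0 < Λ) (μ : ℝ) {z : Site 2} (hz : z ≠ 0)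
    {β : ℝ} (hβ : 0 < β) {Δτ : ℝ} (h0 : 0 ≤ Δτ) (hβ' : Δτ ≤ β) :
    ∑' n : ℤ, ((1 / β : ℝ) : ℂ) * cexp (I * (((2 * n + 1) * π / β * Δτ : ℝ) : ℂ)) *
        mFourierCoeff (Torus.descend (fun y : Momentum => uvSymbolFn c Λ (frameLevel μ 0 ((2 * π) • y)) ((2 * n + 1) * π / β))
          (uvSpatialSymbol_isLatticePeriodic c Λ μ 0 ((2 * n + 1) * π / β))) z =
      -(((1 / (2 * π) : ℝ) : ℂ) * ∑' m : ℤ, (-1 : ℂ) ^ m * 𝓕 (fun om : ℝ => mFourierCoeff (Torus.descend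
        (fun y : Momentum => uvSymbolFn c Λ (frameLevel μ 0 ((2 * π) • y)) om) (uvSpatialSymbol_isLatticePeriodic c Λ μ 0 om)) z)
        ((m * β + (β - Δτ)) / (2 * π))) :=
  tsum_kernelTerm_eq_neg_tsum_images_of_nonneg hc hΛ μ 0 (one_le_klChi2CauchyTab 2) (salmhoferCutoff_flat_cauchy_table_deriv 2)
    (fun q => Summit.HubbardSuperconductivity.HubbardSuperconductivity.Theorems.EngineV8.norm_iteratedFDeriv_frameLevel_zero_le μ le_rfl q) hz hβ h0 hβ'

end Summit.HubbardSuperconductivity.HubbardSuperconductivity.Theorems.KLRegimeSplit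

end
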